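import Summits.QuantumFields.BalabanUV.Beta.EriceRemainderEnclosureHistoryAutonomyComparisonAgeCompositionOldBlockCapWide

/-!
# EriceRemainderEnclosureHistoryAutonomyComparisonAgeCompositionOldBlockCapWider — (E101c) route (N), first order: JOINT CAPS FOR WIDE BLOCKS (spans 8,
# 16, 32).  The ADAPTIVE cascade (E101a)∕(E101b) turns the census question «which top ratios `k₄∕k₃`?» into «which JOINT CAP `x_{k₃} + x_{k₄} ≤ V(F)` at
# span `F`?»: with `{k₃}`, `{k₄}` as SEPARATE levels and the overshoot of the middle level chosen from the top load, the four ages close at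
# `k₃ ≥ 61k₂` as soon as `V(F) ≤ 0.785 ∕ 0.906 ∕ 1.066 ∕ 1.228` on the brackets `F ∈ (4,8] ∕ (8,16] ∕ (16,32] ∕ (32,∞)`
# (`HOME/b2b-balaban-beta-d4-p2/g88/numerics/adaptive3.py`).  The argmax certificate of (E100a)∕(E100e) delivers exactly such caps, for ANY finite set of
# ages in the span: **`old_block_load_le_span8`** (`V = 77∕100`, potential `k^5u^{12}`, 22 + 2 boxes), **`old_block_load_le_span16`** (`89∕100`, `k^4u^{10}`,
# 14 + 3), **`old_block_load_le_span32`** (`21∕20`, `k^4u^{10}`, 16 + 2) — certificates `block_cert_gen.py` → `block_cert_span8∕16∕32.json` (exact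
# `Fraction` checks of the `hbox` conjuncts).  The K-side box lemma is re-proved with the side condition `2Vc_a(F₁−1) ≤ 1 + sh + sh²` in place of
# (E100e)'s `≤ 3` (**`young_in_old_window_of_box''`**): for wide boxes `2Vc_a(F₁−1)` exceeds 3 while `u² + u·sh·w + sh²w² ≥ (1 + sh + sh²)w²` is what the
# chord argument actually uses.

Cell `pub-balaban`, β-function sub-cell, BINDER row D4 «RemainderConst leaves for Bałaban's split» (`HOME/BINDER-OWNERS.md`; owner lineage `b2b-balaban-beta-an4`;
this file by co-owner #2 lineage `b2b-balaban-beta-d4-p2`, generation 88), β-FLOW TEAM duty (1), FREEZE (0) honoured (def-free; nothing restated).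

HONEST FRAMING (page 1, verbatim and binding).  *"Discharging BetaPertH makes Bałaban's UV stability UNCONDITIONAL — a real constructive-QFT result; it is
NOT the continuum limit and NOT the Clay problem."*  THIS FILE DISCHARGES NOTHING OF THE KIND.  Elementary real algebra ∕ real analysis about ABSTRACT
functionals on a box ]0,γ]^ℕ with displayed floors, profiles and signs, and the FIRST-ORDER renewal objects of route (N) built from them — hypotheses of a
census, not facts; the form, signs, ages and moments of Bałaban's (1.22) limit functional are NOT PRINTED ([I] p. 298; GAPS G-t4-U2-1∕-2) and NOT asserted.
Row D4 class UNCHANGED (critical-path width 0; instance 0∕1; D4 DISCHARGE NO DATE).  HONEST DEPENDENCY: continuum YM on T⁴ ⇐ BetaPertH ∧ nine spine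
estimates (0/9 proved); BetaPertH ⇐ (D1) ∧ (D4) ∧ CAP+tail; G-an2-4 gates asym, D1 and NE2/3/4.

THE POINT (README `HOME/b2b-balaban-beta-d4-p2/g88/numerics/alpha_span2.py`, `adaptive2.py`): least certifiable `V` per span `0.752 ∕ 0.868 ∕ ≈1.0` at
`8 ∕ 16 ∕ 32` (truth `0.62 ∕ 0.64 ∕ 0.68`, g86 kit j340398) against the adaptive closure's allowance `0.785 ∕ 0.906 ∕ 1.066`.  Uses (E100e)
`old_in_young_window_of_box'`, `own_window_le'`, `block_load_le_of_argmax`, (E100a) `young_reads_ge`, (E79) `strictAnti_of_memFlow` BY NAME.  NOT CLAIMED: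
spans `> 32` (not needed: beyond 32 the single caps suffice); anything printed — NOT B12 Thm 2, NOT BetaPertH, NOT continuum, NOT Clay.

WHAT IS PROVED ([folklore]; 0 `def`, 0 sorry).  §1 **`young_in_old_window_of_box''`**.  §2 `young_in_old_window_span8`, `old_in_young_window_span8`,
**`old_block_load_le_span8`**.  §3 `…_span16`, **`old_block_load_le_span16`**.  §4 `…_span32`, **`old_block_load_le_span32`**.
-/
noncomputable section
open Finset

namespace Summit.QuantumFields.BalabanUV.Beta.EriceRemainderEnclosureHistoryAutonomyComparisonAgeCompositionOldBlockCapWider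

open Literature.MathematicalPhysics.QuantumFieldTheory.Balaban1983to89
open Literature.MathematicalPhysics.QuantumFieldTheory.Balaban1983to89.T4BetaStationary
open Literature.MathematicalPhysics.QuantumFieldTheory.Balaban1983to89.T4BetaFlowWellPosed
open Summit.QuantumFields.BalabanUV.Beta.EriceRemainderEnclosureHistoryAutonomyOrder (strictAnti_of_memFlow)
open Summit.QuantumFields.BalabanUV.Beta.EriceRemainderEnclosureHistoryAutonomyComparisonAgeCompositionOldBlockLetters (young_reads_ge)
open Summit.QuantumFields.BalabanUV.Beta.EriceRemainderEnclosureHistoryAutonomyComparisonAgeCompositionOldBlockCapWide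
  (old_in_young_window_of_box' own_window_le' block_load_le_of_argmax)

variable {B : (ℕ → ℝ) → ℝ} {γ b gIR : ℝ} {L : ℕ → ℝ} {K : ℕ} {h : ℕ → ℝ}

/-! ## §1 The K-side box lemma with the relaxed side condition -/

/-- **A YOUNGER AGE IN THE ARGMAX WINDOW — parametric box, relaxed side condition.**  As (E100e) `young_in_old_window_of_box'` with `2V·c_a(F₁−1) ≤
1 + sh + sh²` instead of `≤ 3` (the chord identity needs `u² + u·sh·w + sh²w² ≥ 2Vc_a(F₁−1)·w²`, and `u ≥ w`, `sh·w ≥ u ≥ w` give `(1 + sh + sh²)w²`).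
[folklore] -/
theorem young_in_old_window_of_box'' (hmono : ∀ u v : ℕ → ℝ, SeqBox γ u → SeqBox γ v → (∀ j, u j ≤ v j) → B u ≤ B v) (hb : 0 < b)
    (hlo : ∀ u, SeqBox γ u → b ≤ B u) (hh : SeqBox γ h) (hf : MemFlow B gIR h) {i n : ℕ} (h56 : 56 ≤ i) (hin : i < n) (m : ℕ)
    {V : ℝ} {P R : ℕ} (hV : 0 < V) (hQ : 0 < P + R) {F₁ F₂ ca cb sh : ℝ} (hn1 : F₁ * i ≤ n) (hn2 : (n : ℝ) ≤ F₂ * i)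
    (harg : (i : ℝ) ^ P * h (m + i) ^ (2 * (P + R)) ≤ (n : ℝ) ^ P * h (m + n) ^ (2 * (P + R)))
    (hbox : 1 ≤ F₁ ∧ 0 ≤ ca ∧ 0 ≤ cb ∧ 0 < sh ∧ ca ^ 2 * ((1 + F₂) * 56 + 1) ≤ 112 ∧ ca ^ 2 * (1 + F₂) ≤ 2
      ∧ cb ^ 2 * (112 * F₁ + 57) ≤ 112 * F₁ ∧ cb ^ 2 ≤ 1 ∧ F₂ ^ P ≤ sh ^ (2 * (P + R)) ∧ 2 * V * (ca * (F₁ - 1)) ≤ 1 + sh + sh ^ 2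
      ∧ sh ^ 3 ≤ 2 * V * (ca * (F₁ - 1) * sh + cb)) :
    (i : ℝ) * h (m + i) ^ 3 / 2 ≤ V * (h (m + n) ^ 2 * ∑ q ∈ range n, h (m + q + 1 + i)) := by
  obtain ⟨hF1, hca0, hcb0, hsh, hc1a, hc1b, hc2a, hc2b, hc3, hc4, hc5⟩ := hbox
  have hpos : ∀ n, 0 < h n := fun n => (hh n).1
  have hanti := (strictAnti_of_memFlow hb hlo hh hf).antitone
  have hir : (56 : ℝ) ≤ i := by exact_mod_cast h56
  have hinr : (i : ℝ) + 1 ≤ n := by exact_mod_cast hin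
  have hipos : (0 : ℝ) < i := by linarith
  have hF2 : 1 ≤ F₂ := le_of_mul_le_mul_right (by linarith : (1 : ℝ) * i ≤ F₂ * i) hipos
  have hreads := young_reads_ge hmono hb hlo hh hf (by omega) hin (ca := ca) (cb := cb) ?_ ?_ m
  rotate_left
  · have h1 : ca ^ 2 * ((i : ℝ) + n + 1) ≤ ca ^ 2 * ((1 + F₂) * i + 1) := mul_le_mul_of_nonneg_left (by linarith) (sq_nonneg ca)
    have h2 := mul_le_mul_of_nonneg_left hir (sub_nonneg.2 hc1b)
    nlinarith
  · have hE : 0 ≤ 2 * F₁ - 2 * cb ^ 2 * F₁ - cb ^ 2 := by nlinarith [sq_nonneg cb]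
    have h1 := mul_le_mul_of_nonneg_left hn1 (by nlinarith : (0 : ℝ) ≤ 2 - 2 * cb ^ 2)
    have h2 := mul_le_mul_of_nonneg_left hir hE
    nlinarith
  set u := h (m + i) with hu_def
  set w := h (m + n) with hw_def
  set Rd := ∑ q ∈ range n, h (m + q + 1 + i) with hRd_def
  have hu : 0 < u := hpos _
  have hw : 0 < w := hpos _
  have hwu : w ≤ u := hanti (by omega)
  have hush : u ≤ sh * w := by
    have h1 : (n : ℝ) ^ P ≤ (F₂ * i) ^ P := pow_le_pow_left₀ (by positivity) hn2 P
    have h3 : (i : ℝ) ^ P * u ^ (2 * (P + R)) ≤ (i : ℝ) ^ P * (sh * w) ^ (2 * (P + R)) := by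
      calc (i : ℝ) ^ P * u ^ (2 * (P + R)) ≤ (n : ℝ) ^ P * w ^ (2 * (P + R)) := harg
        _ ≤ (F₂ * i) ^ P * w ^ (2 * (P + R)) := mul_le_mul_of_nonneg_right h1 (by positivity)
        _ = F₂ ^ P * ((i : ℝ) ^ P * w ^ (2 * (P + R))) := by ring
        _ ≤ sh ^ (2 * (P + R)) * ((i : ℝ) ^ P * w ^ (2 * (P + R))) := mul_le_mul_of_nonneg_right hc3 (by positivity)
        _ = (i : ℝ) ^ P * (sh * w) ^ (2 * (P + R)) := by ring
    exact le_of_pow_le_pow_left₀ (by omega) (by positivity) (le_of_mul_le_mul_left h3 (by positivity))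
  -- the cube under its chord, with Q ≥ (1 + sh + sh²)w² ≥ A w²
  have hkey : u ^ 3 ≤ 2 * V * (ca * (F₁ - 1)) * u * w ^ 2 + 2 * V * cb * w ^ 3 := by
    have hq : 0 ≤ u ^ 2 + u * (sh * w) + (sh * w) ^ 2 - 2 * V * (ca * (F₁ - 1)) * w ^ 2 := by
      have h1 : w ^ 2 ≤ u ^ 2 := pow_le_pow_left₀ hw.le hwu 2
      have h2 : w * (sh * w) ≤ u * (sh * w) := mul_le_mul_of_nonneg_right hwu (by positivity)
      have h4 := mul_le_mul_of_nonneg_right hc4 (sq_nonneg w)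
      nlinarith
    have hprod := mul_nonneg (sub_nonneg.2 hush) hq
    have hclo : w ^ 3 * sh ^ 3 ≤ w ^ 3 * (2 * V * (ca * (F₁ - 1) * sh + cb)) := mul_le_mul_of_nonneg_left hc5 (by positivity)
    have e : u ^ 3 - (2 * V * (ca * (F₁ - 1)) * u * w ^ 2 + 2 * V * cb * w ^ 3)
        = -((sh * w - u) * (u ^ 2 + u * (sh * w) + (sh * w) ^ 2 - 2 * V * (ca * (F₁ - 1)) * w ^ 2))
          + (w ^ 3 * sh ^ 3 - w ^ 3 * (2 * V * (ca * (F₁ - 1) * sh + cb))) := by ring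
    linarith
  have hG : (F₁ - 1) * i ≤ (n : ℝ) - i := by linarith
  have hA : 2 * V * (ca * (F₁ - 1)) * u * w ^ 2 * i ≤ 2 * V * ca * ((n : ℝ) - i) * u * w ^ 2 := by
    have h1 := mul_le_mul_of_nonneg_left hG (by positivity : (0 : ℝ) ≤ 2 * V * ca * u * w ^ 2)
    have e1 : 2 * V * (ca * (F₁ - 1)) * u * w ^ 2 * i = 2 * V * ca * u * w ^ 2 * ((F₁ - 1) * i) := by ring
    have e2 : 2 * V * ca * ((n : ℝ) - i) * u * w ^ 2 = 2 * V * ca * u * w ^ 2 * ((n : ℝ) - i) := by ring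
    linarith
  have hB : (i : ℝ) * u ^ 3 ≤ 2 * V * (w ^ 2 * (ca * ((n : ℝ) - i) * u + cb * i * w)) := by
    have h1 := mul_le_mul_of_nonneg_right hkey hipos.le
    have e1 : (2 * V * (ca * (F₁ - 1)) * u * w ^ 2 + 2 * V * cb * w ^ 3) * i
        = 2 * V * (ca * (F₁ - 1)) * u * w ^ 2 * i + 2 * V * cb * w ^ 3 * i := by ring
    have e2 : 2 * V * (w ^ 2 * (ca * ((n : ℝ) - i) * u + cb * i * w))
        = 2 * V * ca * ((n : ℝ) - i) * u * w ^ 2 + 2 * V * cb * w ^ 3 * i := by ring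
    linarith
  have hC := mul_le_mul_of_nonneg_left hreads (by positivity : (0 : ℝ) ≤ 2 * V * w ^ 2)
  have e3 : 2 * V * w ^ 2 * (ca * ((n : ℝ) - i) * u + cb * i * w) = 2 * V * (w ^ 2 * (ca * ((n : ℝ) - i) * u + cb * i * w)) := by ring
  have e4 : 2 * V * w ^ 2 * Rd = 2 * (V * (w ^ 2 * Rd)) := by ring
  linarith

/-! ## §2 Span 8: `V = 77 / 100`, potential `k^5·u^12` -/

/-- **A YOUNGER AGE IN THE ARGMAX WINDOW, SPAN 8** (22 boxes of `n∕i ∈ [1, 8]`, `V = 77 / 100`, potential `k^5·h^12`). [folklore] -/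
theorem young_in_old_window_span8 (hmono : ∀ u v : ℕ → ℝ, SeqBox γ u → SeqBox γ v → (∀ j, u j ≤ v j) → B u ≤ B v) (hb : 0 < b)
    (hlo : ∀ u, SeqBox γ u → b ≤ B u) (hh : SeqBox γ h) (hf : MemFlow B gIR h) {i n : ℕ} (h56 : 56 ≤ i) (hin : i < n)
    (hn2 : n ≤ 8 * i) (m : ℕ) (harg : (i : ℝ) ^ 5 * h (m + i) ^ (2 * (5 + 1)) ≤ (n : ℝ) ^ 5 * h (m + n) ^ (2 * (5 + 1))) :
    (i : ℝ) * h (m + i) ^ 3 / 2 ≤ (77 / 100 : ℝ) * (h (m + n) ^ 2 * ∑ q ∈ range n, h (m + q + 1 + i)) := by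
  have hV : (0 : ℝ) < 77 / 100 := by norm_num
  have hF0 : (1 : ℝ) * i ≤ n := by rw [one_mul]; exact_mod_cast hin.le
  have hn2r : (n : ℝ) ≤ 8 * i := by exact_mod_cast hn2
  rcases le_or_gt (n : ℝ) (599 / 500 * i) with h1 | h1
  · exact young_in_old_window_of_box'' hmono hb hlo hh hf h56 hin m hV (by norm_num) hF0 h1 harg
      (ca := 19 / 20) (cb := 407 / 500) (sh := 5391 / 5000) (by norm_num)
  rcases le_or_gt (n : ℝ) (183 / 125 * i) with h2 | h2
  · exact young_in_old_window_of_box'' hmono hb hlo hh hf h56 hin m hV (by norm_num) h1.le h2 harg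
      (ca := 561 / 625) (cb := 8377 / 10000) (sh := 5861 / 5000) (by norm_num)
  rcases le_or_gt (n : ℝ) (1807 / 1000 * i) with h3 | h3
  · exact young_in_old_window_of_box'' hmono hb hlo hh hf h56 hin m hV (by norm_num) h2.le h3 harg
      (ca := 4207 / 5000) (cb := 4307 / 5000) (sh := 3199 / 2500) (by norm_num)
  rcases le_or_gt (n : ℝ) (557 / 250 * i) with h4 | h4
  · exact young_in_old_window_of_box'' hmono hb hlo hh hf h56 hin m hV (by norm_num) h3.le h4 harg
      (ca := 7849 / 10000) (cb := 8833 / 10000) (sh := 13963 / 10000) (by norm_num)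
  rcases le_or_gt (n : ℝ) (679 / 250 * i) with h5 | h5
  · exact young_in_old_window_of_box'' hmono hb hlo hh hf h56 hin m hV (by norm_num) h4.le h5 harg
      (ca := 3659 / 5000) (cb := 4511 / 5000) (sh := 3791 / 2500) (by norm_num)
  rcases le_or_gt (n : ℝ) (3253 / 1000 * i) with h6 | h6
  · exact young_in_old_window_of_box'' hmono hb hlo hh hf h56 hin m hV (by norm_num) h5.le h6 harg
      (ca := 6843 / 10000) (cb := 9177 / 10000) (sh := 4087 / 2500) (by norm_num)
  rcases le_or_gt (n : ℝ) (1907 / 500 * i) with h7 | h7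
  · exact young_in_old_window_of_box'' hmono hb hlo hh hf h56 hin m hV (by norm_num) h6.le h7 harg
      (ca := 6433 / 10000) (cb := 9299 / 10000) (sh := 4367 / 2500) (by norm_num)
  rcases le_or_gt (n : ℝ) (2187 / 500 * i) with h8 | h8
  · exact young_in_old_window_of_box'' hmono hb hlo hh hf h56 hin m hV (by norm_num) h7.le h8 harg
      (ca := 609 / 1000) (cb := 587 / 625) (sh := 3699 / 2000) (by norm_num)
  rcases le_or_gt (n : ℝ) (614 / 125 * i) with h9 | h9
  · exact young_in_old_window_of_box'' hmono hb hlo hh hf h56 hin m hV (by norm_num) h8.le h9 harg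
      (ca := 5807 / 10000) (cb := 1183 / 1250) (sh := 1941 / 1000) (by norm_num)
  rcases le_or_gt (n : ℝ) (1353 / 250 * i) with h10 | h10
  · exact young_in_old_window_of_box'' hmono hb hlo hh hf h56 hin m hV (by norm_num) h9.le h10 harg
      (ca := 5577 / 10000) (cb := 9519 / 10000) (sh := 2021 / 1000) (by norm_num)
  rcases le_or_gt (n : ℝ) (5863 / 1000 * i) with h11 | h11
  · exact young_in_old_window_of_box'' hmono hb hlo hh hf h56 hin m hV (by norm_num) h10.le h11 harg
      (ca := 5391 / 10000) (cb := 239 / 250) (sh := 1306 / 625) (by norm_num)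
  rcases le_or_gt (n : ℝ) (3131 / 500 * i) with h12 | h12
  · exact young_in_old_window_of_box'' hmono hb hlo hh hf h56 hin m hV (by norm_num) h11.le h12 harg
      (ca := 5241 / 10000) (cb := 1199 / 1250) (sh := 21477 / 10000) (by norm_num)
  rcases le_or_gt (n : ℝ) (6607 / 1000 * i) with h13 | h13
  · exact young_in_old_window_of_box'' hmono hb hlo hh hf h56 hin m hV (by norm_num) h12.le h13 harg
      (ca := 5121 / 10000) (cb := 601 / 625) (sh := 10981 / 5000) (by norm_num)
  rcases le_or_gt (n : ℝ) (3451 / 500 * i) with h14 | h14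
  · exact young_in_old_window_of_box'' hmono hb hlo hh hf h56 hin m hV (by norm_num) h13.le h14 harg
      (ca := 201 / 400) (cb := 1927 / 2000) (sh := 11183 / 5000) (by norm_num)
  rcases le_or_gt (n : ℝ) (7151 / 1000 * i) with h15 | h15
  · exact young_in_old_window_of_box'' hmono hb hlo hh hf h56 hin m hV (by norm_num) h14.le h15 harg
      (ca := 1237 / 2500) (cb := 193 / 200) (sh := 11349 / 5000) (by norm_num)
  rcases le_or_gt (n : ℝ) (7357 / 1000 * i) with h16 | h16
  · exact young_in_old_window_of_box'' hmono hb hlo hh hf h56 hin m hV (by norm_num) h15.le h16 harg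
      (ca := 2443 / 5000) (cb := 4831 / 5000) (sh := 22969 / 10000) (by norm_num)
  rcases le_or_gt (n : ℝ) (7527 / 1000 * i) with h17 | h17
  · exact young_in_old_window_of_box'' hmono hb hlo hh hf h56 hin m hV (by norm_num) h16.le h17 harg
      (ca := 4837 / 10000) (cb := 9671 / 10000) (sh := 5797 / 2500) (by norm_num)
  rcases le_or_gt (n : ℝ) (7667 / 1000 * i) with h18 | h18
  · exact young_in_old_window_of_box'' hmono hb hlo hh hf h56 hin m hV (by norm_num) h17.le h18 harg
      (ca := 2399 / 5000) (cb := 4839 / 5000) (sh := 23367 / 10000) (by norm_num)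
  rcases le_or_gt (n : ℝ) (3891 / 500 * i) with h19 | h19
  · exact young_in_old_window_of_box'' hmono hb hlo hh hf h56 hin m hV (by norm_num) h18.le h19 harg
      (ca := 4767 / 10000) (cb := 9683 / 10000) (sh := 2939 / 1250) (by norm_num)
  rcases le_or_gt (n : ℝ) (1969 / 250 * i) with h20 | h20
  · exact young_in_old_window_of_box'' hmono hb hlo hh hf h56 hin m hV (by norm_num) h19.le h20 harg
      (ca := 2371 / 5000) (cb := 1211 / 1250) (sh := 2363 / 1000) (by norm_num)
  rcases le_or_gt (n : ℝ) (7951 / 1000 * i) with h21 | h21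
  · exact young_in_old_window_of_box'' hmono hb hlo hh hf h56 hin m hV (by norm_num) h20.le h21 harg
      (ca := 2361 / 5000) (cb := 9691 / 10000) (sh := 5931 / 2500) (by norm_num)
  · exact young_in_old_window_of_box'' hmono hb hlo hh hf h56 hin m hV (by norm_num) h21.le hn2r harg
      (ca := 4709 / 10000) (cb := 4847 / 5000) (sh := 4757 / 2000) (by norm_num)

/-- **AN OLDER AGE IN THE ARGMAX WINDOW, SPAN 8** (2 boxes of `i∕n ∈ [1, 8]`). [folklore] -/
theorem old_in_young_window_span8 (hmono : ∀ u v : ℕ → ℝ, SeqBox γ u → SeqBox γ v → (∀ j, u j ≤ v j) → B u ≤ B v) (hb : 0 < b)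
    (hlo : ∀ u, SeqBox γ u → b ≤ B u) (hh : SeqBox γ h) (hf : MemFlow B gIR h) {i n : ℕ} (h56 : 56 ≤ n) (hni : n < i)
    (hi2 : i ≤ 8 * n) (m : ℕ) (harg : (i : ℝ) ^ 5 * h (m + i) ^ (2 * (5 + 1)) ≤ (n : ℝ) ^ 5 * h (m + n) ^ (2 * (5 + 1))) :
    (i : ℝ) * h (m + i) ^ 3 / 2 ≤ (77 / 100 : ℝ) * (h (m + n) ^ 2 * ∑ q ∈ range n, h (m + q + 1 + i)) := by
  have hV : (0 : ℝ) < 77 / 100 := by norm_num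
  have hF0 : (1 : ℝ) * n ≤ i := by rw [one_mul]; exact_mod_cast hni.le
  have hi2r : (i : ℝ) ≤ 8 * n := by exact_mod_cast hi2
  rcases le_or_gt (i : ℝ) (1939 / 500 * n) with h1 | h1
  · exact old_in_young_window_of_box' hmono hb hlo hh hf h56 hni m hV (by norm_num) hF0 h1 harg
      (cb := 407 / 500) (sl := 3989 / 5000) (by norm_num)
  · exact old_in_young_window_of_box' hmono hb hlo hh hf h56 hni m hV (by norm_num) h1.le hi2r harg
      (cb := 4701 / 5000) (sl := 7071 / 10000) (by norm_num)

/-- **THE SPAN-8 CAP.**  ANY finite set `S` of ages inside `[lo, hi]` with `56 ≤ lo`, `hi ≤ 8·lo`, `hi < K`: `Σ_{k∈S} k·L_kh_{m+k}³∕2 ≤ 77 / 100` at every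
pin ((E100e) `block_load_le_of_argmax` with the potential `k^5·h^12`). [folklore] -/
theorem old_block_load_le_span8 (hmono : ∀ u v : ℕ → ℝ, SeqBox γ u → SeqBox γ v → (∀ j, u j ≤ v j) → B u ≤ B v)
    (hL : ∀ k, 0 ≤ L k) (hb : 0 < b) (hlo : ∀ u, SeqBox γ u → b ≤ B u) (hdom : ∀ u, SeqBox γ u → ∑ k ∈ range K, L k * u k ≤ B u)
    (hh : SeqBox γ h) (hf : MemFlow B gIR h) {S : Finset ℕ} {lo hi : ℕ} (h56 : 56 ≤ lo) (hhi : hi ≤ 8 * lo) (hhiK : hi < K)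
    (hS : ∀ k ∈ S, lo ≤ k ∧ k ≤ hi) (m : ℕ) : ∑ k ∈ S, (k : ℝ) * (L k * h (m + k) ^ 3 / 2) ≤ 77 / 100 := by
  refine block_load_le_of_argmax hL hdom hh hf (fun k hk => lt_of_le_of_lt (hS k hk).2 hhiK) (by norm_num) (P := 5) (Q := (2 * (5 + 1))) m
    fun i hi n hn harg => ?_
  obtain ⟨hi1, hi2⟩ := hS i hi
  obtain ⟨hn1, hn2⟩ := hS n hn
  rcases lt_trichotomy i n with hlt | heq | hgt
  · exact young_in_old_window_span8 hmono hb hlo hh hf (by omega) hlt (by omega) m harg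
  · subst heq; exact own_window_le' hmono hb hlo hh hf (by omega) m (by norm_num)
  · exact old_in_young_window_span8 hmono hb hlo hh hf (by omega) hgt (by omega) m harg

/-! ## §3 Span 16: `V = 89 / 100`, potential `k^4·u^10` -/

/-- **A YOUNGER AGE IN THE ARGMAX WINDOW, SPAN 16** (14 boxes of `n∕i ∈ [1, 16]`, `V = 89 / 100`, potential `k^4·h^10`). [folklore] -/
theorem young_in_old_window_span16 (hmono : ∀ u v : ℕ → ℝ, SeqBox γ u → SeqBox γ v → (∀ j, u j ≤ v j) → B u ≤ B v) (hb : 0 < b)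
    (hlo : ∀ u, SeqBox γ u → b ≤ B u) (hh : SeqBox γ h) (hf : MemFlow B gIR h) {i n : ℕ} (h56 : 56 ≤ i) (hin : i < n)
    (hn2 : n ≤ 16 * i) (m : ℕ) (harg : (i : ℝ) ^ 4 * h (m + i) ^ (2 * (4 + 1)) ≤ (n : ℝ) ^ 4 * h (m + n) ^ (2 * (4 + 1))) :
    (i : ℝ) * h (m + i) ^ 3 / 2 ≤ (89 / 100 : ℝ) * (h (m + n) ^ 2 * ∑ q ∈ range n, h (m + q + 1 + i)) := by
  have hV : (0 : ℝ) < 89 / 100 := by norm_num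
  have hF0 : (1 : ℝ) * i ≤ n := by rw [one_mul]; exact_mod_cast hin.le
  have hn2r : (n : ℝ) ≤ 16 * i := by exact_mod_cast hn2
  rcases le_or_gt (n : ℝ) (1361 / 1000 * i) with h1 | h1
  · exact young_in_old_window_of_box'' hmono hb hlo hh hf h56 hin m hV (by norm_num) hF0 h1 harg
      (ca := 9169 / 10000) (cb := 407 / 500) (sh := 11313 / 10000) (by norm_num)
  rcases le_or_gt (n : ℝ) (967 / 500 * i) with h2 | h2
  · exact young_in_old_window_of_box'' hmono hb hlo hh hf h56 hin m hV (by norm_num) h1.le h2 harg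
      (ca := 8231 / 10000) (cb := 8531 / 10000) (sh := 651 / 500) (by norm_num)
  rcases le_or_gt (n : ℝ) (693 / 250 * i) with h3 | h3
  · exact young_in_old_window_of_box'' hmono hb hlo hh hf h56 hin m hV (by norm_num) h2.le h3 harg
      (ca := 454 / 625) (cb := 8897 / 10000) (sh := 3759 / 2500) (by norm_num)
  rcases le_or_gt (n : ℝ) (486 / 125 * i) with h4 | h4
  · exact young_in_old_window_of_box'' hmono hb hlo hh hf h56 hin m hV (by norm_num) h3.le h4 harg
      (ca := 399 / 625) (cb := 9191 / 10000) (sh := 3443 / 2000) (by norm_num)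
  rcases le_or_gt (n : ℝ) (5247 / 1000 * i) with h5 | h5
  · exact young_in_old_window_of_box'' hmono hb hlo hh hf h56 hin m hV (by norm_num) h4.le h5 harg
      (ca := 113 / 200) (cb := 9403 / 10000) (sh := 1213 / 625) (by norm_num)
  rcases le_or_gt (n : ℝ) (6773 / 1000 * i) with h6 | h6
  · exact young_in_old_window_of_box'' hmono hb hlo hh hf h56 hin m hV (by norm_num) h5.le h6 harg
      (ca := 2533 / 5000) (cb := 9547 / 10000) (sh := 10747 / 5000) (by norm_num)
  rcases le_or_gt (n : ℝ) (4187 / 500 * i) with h7 | h7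
  · exact young_in_old_window_of_box'' hmono hb hlo hh hf h56 hin m hV (by norm_num) h6.le h7 harg
      (ca := 2307 / 5000) (cb := 2411 / 2500) (sh := 11699 / 5000) (by norm_num)
  rcases le_or_gt (n : ℝ) (9961 / 1000 * i) with h8 | h8
  · exact young_in_old_window_of_box'' hmono hb hlo hh hf h56 hin m hV (by norm_num) h7.le h8 harg
      (ca := 1067 / 2500) (cb := 9709 / 10000) (sh := 627 / 250) (by norm_num)
  rcases le_or_gt (n : ℝ) (11463 / 1000 * i) with h9 | h9
  · exact young_in_old_window_of_box'' hmono hb hlo hh hf h56 hin m hV (by norm_num) h8.le h9 harg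
      (ca := 4003 / 10000) (cb := 9753 / 10000) (sh := 26529 / 10000) (by norm_num)
  rcases le_or_gt (n : ℝ) (1604 / 125 * i) with h10 | h10
  · exact young_in_old_window_of_box'' hmono hb hlo hh hf h56 hin m hV (by norm_num) h9.le h10 harg
      (ca := 19 / 50) (cb := 1957 / 2000) (sh := 13877 / 5000) (by norm_num)
  rcases le_or_gt (n : ℝ) (14043 / 1000 * i) with h11 | h11
  · exact young_in_old_window_of_box'' hmono hb hlo hh hf h56 hin m hV (by norm_num) h10.le h11 harg
      (ca := 911 / 2500) (cb := 9807 / 10000) (sh := 28773 / 10000) (by norm_num)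
  rcases le_or_gt (n : ℝ) (1509 / 100 * i) with h12 | h12
  · exact young_in_old_window_of_box'' hmono hb hlo hh hf h56 hin m hV (by norm_num) h11.le h12 harg
      (ca := 3523 / 10000) (cb := 9823 / 10000) (sh := 29613 / 10000) (by norm_num)
  rcases le_or_gt (n : ℝ) (7989 / 500 * i) with h13 | h13
  · exact young_in_old_window_of_box'' hmono hb hlo hh hf h56 hin m hV (by norm_num) h12.le h13 harg
      (ca := 343 / 1000) (cb := 1967 / 2000) (sh := 15149 / 5000) (by norm_num)
  · exact young_in_old_window_of_box'' hmono hb hlo hh hf h56 hin m hV (by norm_num) h13.le hn2r harg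
      (ca := 857 / 2500) (cb := 2461 / 2500) (sh := 6063 / 2000) (by norm_num)

/-- **AN OLDER AGE IN THE ARGMAX WINDOW, SPAN 16** (3 boxes of `i∕n ∈ [1, 16]`). [folklore] -/
theorem old_in_young_window_span16 (hmono : ∀ u v : ℕ → ℝ, SeqBox γ u → SeqBox γ v → (∀ j, u j ≤ v j) → B u ≤ B v) (hb : 0 < b)
    (hlo : ∀ u, SeqBox γ u → b ≤ B u) (hh : SeqBox γ h) (hf : MemFlow B gIR h) {i n : ℕ} (h56 : 56 ≤ n) (hni : n < i)
    (hi2 : i ≤ 16 * n) (m : ℕ) (harg : (i : ℝ) ^ 4 * h (m + i) ^ (2 * (4 + 1)) ≤ (n : ℝ) ^ 4 * h (m + n) ^ (2 * (4 + 1))) :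
    (i : ℝ) * h (m + i) ^ 3 / 2 ≤ (89 / 100 : ℝ) * (h (m + n) ^ 2 * ∑ q ∈ range n, h (m + q + 1 + i)) := by
  have hV : (0 : ℝ) < 89 / 100 := by norm_num
  have hF0 : (1 : ℝ) * n ≤ i := by rw [one_mul]; exact_mod_cast hni.le
  have hi2r : (i : ℝ) ≤ 16 * n := by exact_mod_cast hi2
  rcases le_or_gt (i : ℝ) (798 / 125 * n) with h1 | h1
  · exact old_in_young_window_of_box' hmono hb hlo hh hf h56 hni m hV (by norm_num) hF0 h1 harg
      (cb := 407 / 500) (sl := 3451 / 5000) (by norm_num)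
  rcases le_or_gt (i : ℝ) (14733 / 1000 * n) with h2 | h2
  · exact old_in_young_window_of_box' hmono hb hlo hh hf h56 hni m hV (by norm_num) h1.le h2 harg
      (cb := 9623 / 10000) (sl := 5839 / 10000) (by norm_num)
  · exact old_in_young_window_of_box' hmono hb hlo hh hf h56 hni m hV (by norm_num) h2.le hi2r harg
      (cb := 9831 / 10000) (sl := 5743 / 10000) (by norm_num)

/-- **THE SPAN-16 CAP.**  ANY finite set `S` of ages inside `[lo, hi]` with `56 ≤ lo`, `hi ≤ 16·lo`, `hi < K`: `Σ_{k∈S} k·L_kh_{m+k}³∕2 ≤ 89 / 100` at every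
pin ((E100e) `block_load_le_of_argmax` with the potential `k^4·h^10`). [folklore] -/
theorem old_block_load_le_span16 (hmono : ∀ u v : ℕ → ℝ, SeqBox γ u → SeqBox γ v → (∀ j, u j ≤ v j) → B u ≤ B v)
    (hL : ∀ k, 0 ≤ L k) (hb : 0 < b) (hlo : ∀ u, SeqBox γ u → b ≤ B u) (hdom : ∀ u, SeqBox γ u → ∑ k ∈ range K, L k * u k ≤ B u)
    (hh : SeqBox γ h) (hf : MemFlow B gIR h) {S : Finset ℕ} {lo hi : ℕ} (h56 : 56 ≤ lo) (hhi : hi ≤ 16 * lo) (hhiK : hi < K)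
    (hS : ∀ k ∈ S, lo ≤ k ∧ k ≤ hi) (m : ℕ) : ∑ k ∈ S, (k : ℝ) * (L k * h (m + k) ^ 3 / 2) ≤ 89 / 100 := by
  refine block_load_le_of_argmax hL hdom hh hf (fun k hk => lt_of_le_of_lt (hS k hk).2 hhiK) (by norm_num) (P := 4) (Q := (2 * (4 + 1))) m
    fun i hi n hn harg => ?_
  obtain ⟨hi1, hi2⟩ := hS i hi
  obtain ⟨hn1, hn2⟩ := hS n hn
  rcases lt_trichotomy i n with hlt | heq | hgt
  · exact young_in_old_window_span16 hmono hb hlo hh hf (by omega) hlt (by omega) m harg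
  · subst heq; exact own_window_le' hmono hb hlo hh hf (by omega) m (by norm_num)
  · exact old_in_young_window_span16 hmono hb hlo hh hf (by omega) hgt (by omega) m harg

/-! ## §4 Span 32: `V = 21 / 20`, potential `k^4·u^10` -/

/-- **A YOUNGER AGE IN THE ARGMAX WINDOW, SPAN 32** (16 boxes of `n∕i ∈ [1, 32]`, `V = 21 / 20`, potential `k^4·h^10`). [folklore] -/
theorem young_in_old_window_span32 (hmono : ∀ u v : ℕ → ℝ, SeqBox γ u → SeqBox γ v → (∀ j, u j ≤ v j) → B u ≤ B v) (hb : 0 < b)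
    (hlo : ∀ u, SeqBox γ u → b ≤ B u) (hh : SeqBox γ h) (hf : MemFlow B gIR h) {i n : ℕ} (h56 : 56 ≤ i) (hin : i < n)
    (hn2 : n ≤ 32 * i) (m : ℕ) (harg : (i : ℝ) ^ 4 * h (m + i) ^ (2 * (4 + 1)) ≤ (n : ℝ) ^ 4 * h (m + n) ^ (2 * (4 + 1))) :
    (i : ℝ) * h (m + i) ^ 3 / 2 ≤ (21 / 20 : ℝ) * (h (m + n) ^ 2 * ∑ q ∈ range n, h (m + q + 1 + i)) := by
  have hV : (0 : ℝ) < 21 / 20 := by norm_num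
  have hF0 : (1 : ℝ) * i ≤ n := by rw [one_mul]; exact_mod_cast hin.le
  have hn2r : (n : ℝ) ≤ 32 * i := by exact_mod_cast hn2
  rcases le_or_gt (n : ℝ) (1563 / 1000 * i) with h1 | h1
  · exact young_in_old_window_of_box'' hmono hb hlo hh hf h56 hin m hV (by norm_num) hF0 h1 harg
      (ca := 8803 / 10000) (cb := 407 / 500) (sh := 2989 / 2500) (by norm_num)
  rcases le_or_gt (n : ℝ) (1287 / 500 * i) with h2 | h2
  · exact young_in_old_window_of_box'' hmono hb hlo hh hf h56 hin m hV (by norm_num) h1.le h2 harg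
      (ca := 3731 / 5000) (cb := 1737 / 2000) (sh := 14597 / 10000) (by norm_num)
  rcases le_or_gt (n : ℝ) (4171 / 1000 * i) with h3 | h3
  · exact young_in_old_window_of_box'' hmono hb hlo hh hf h56 hin m hV (by norm_num) h2.le h3 harg
      (ca := 388 / 625) (cb := 9137 / 10000) (sh := 8853 / 5000) (by norm_num)
  rcases le_or_gt (n : ℝ) (6383 / 1000 * i) with h4 | h4
  · exact young_in_old_window_of_box'' hmono hb hlo hh hf h56 hin m hV (by norm_num) h3.le h4 harg
      (ca := 2599 / 5000) (cb := 118 / 125) (sh := 2099 / 1000) (by norm_num)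
  rcases le_or_gt (n : ℝ) (1139 / 125 * i) with h5 | h5
  · exact young_in_old_window_of_box'' hmono hb hlo hh hf h56 hin m hV (by norm_num) h4.le h5 harg
      (ca := 4443 / 10000) (cb := 9623 / 10000) (sh := 12101 / 5000) (by norm_num)
  rcases le_or_gt (n : ℝ) (12171 / 1000 * i) with h6 | h6
  · exact young_in_old_window_of_box'' hmono hb hlo hh hf h56 hin m hV (by norm_num) h5.le h6 harg
      (ca := 1947 / 5000) (cb := 9731 / 10000) (sh := 27173 / 10000) (by norm_num)
  rcases le_or_gt (n : ℝ) (15347 / 1000 * i) with h7 | h7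
  · exact young_in_old_window_of_box'' hmono hb hlo hh hf h56 hin m hV (by norm_num) h6.le h7 harg
      (ca := 699 / 2000) (cb := 9797 / 10000) (sh := 14907 / 5000) (by norm_num)
  rcases le_or_gt (n : ℝ) (18451 / 1000 * i) with h8 | h8
  · exact young_in_old_window_of_box'' hmono hb hlo hh hf h56 hin m hV (by norm_num) h7.le h8 harg
      (ca := 641 / 2000) (cb := 4919 / 5000) (sh := 32093 / 10000) (by norm_num)
  rcases le_or_gt (n : ℝ) (21337 / 1000 * i) with h9 | h9
  · exact young_in_old_window_of_box'' hmono hb hlo hh hf h56 hin m hV (by norm_num) h8.le h9 harg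
      (ca := 2991 / 10000) (cb := 1233 / 1250) (sh := 17007 / 5000) (by norm_num)
  rcases le_or_gt (n : ℝ) (23919 / 1000 * i) with h10 | h10
  · exact young_in_old_window_of_box'' hmono hb hlo hh hf h56 hin m hV (by norm_num) h9.le h10 harg
      (ca := 177 / 625) (cb := 4941 / 5000) (sh := 8901 / 2500) (by norm_num)
  rcases le_or_gt (n : ℝ) (13077 / 500 * i) with h11 | h11
  · exact young_in_old_window_of_box'' hmono hb hlo hh hf h56 hin m hV (by norm_num) h10.le h11 harg
      (ca := 2713 / 10000) (cb := 1979 / 2000) (sh := 369 / 100) (by norm_num)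
  rcases le_or_gt (n : ℝ) (28051 / 1000 * i) with h12 | h12
  · exact young_in_old_window_of_box'' hmono hb hlo hh hf h56 hin m hV (by norm_num) h11.le h12 harg
      (ca := 2623 / 10000) (cb := 619 / 625) (sh := 9487 / 2500) (by norm_num)
  rcases le_or_gt (n : ℝ) (7407 / 250 * i) with h13 | h13
  · exact young_in_old_window_of_box'' hmono hb hlo hh hf h56 hin m hV (by norm_num) h12.le h13 harg
      (ca := 1277 / 5000) (cb := 991 / 1000) (sh := 38787 / 10000) (by norm_num)
  rcases le_or_gt (n : ℝ) (15463 / 500 * i) with h14 | h14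
  · exact young_in_old_window_of_box'' hmono hb hlo hh hf h56 hin m hV (by norm_num) h13.le h14 harg
      (ca := 1251 / 5000) (cb := 1983 / 2000) (sh := 19729 / 5000) (by norm_num)
  rcases le_or_gt (n : ℝ) (31977 / 1000 * i) with h15 | h15
  · exact young_in_old_window_of_box'' hmono hb hlo hh hf h56 hin m hV (by norm_num) h14.le h15 harg
      (ca := 1231 / 5000) (cb := 4959 / 5000) (sh := 39989 / 10000) (by norm_num)
  · exact young_in_old_window_of_box'' hmono hb hlo hh hf h56 hin m hV (by norm_num) h15.le hn2r harg
      (ca := 2461 / 10000) (cb := 9921 / 10000) (sh := 4) (by norm_num)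

/-- **AN OLDER AGE IN THE ARGMAX WINDOW, SPAN 32** (2 boxes of `i∕n ∈ [1, 32]`). [folklore] -/
theorem old_in_young_window_span32 (hmono : ∀ u v : ℕ → ℝ, SeqBox γ u → SeqBox γ v → (∀ j, u j ≤ v j) → B u ≤ B v) (hb : 0 < b)
    (hlo : ∀ u, SeqBox γ u → b ≤ B u) (hh : SeqBox γ h) (hf : MemFlow B gIR h) {i n : ℕ} (h56 : 56 ≤ n) (hni : n < i)
    (hi2 : i ≤ 32 * n) (m : ℕ) (harg : (i : ℝ) ^ 4 * h (m + i) ^ (2 * (4 + 1)) ≤ (n : ℝ) ^ 4 * h (m + n) ^ (2 * (4 + 1))) :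
    (i : ℝ) * h (m + i) ^ 3 / 2 ≤ (21 / 20 : ℝ) * (h (m + n) ^ 2 * ∑ q ∈ range n, h (m + q + 1 + i)) := by
  have hV : (0 : ℝ) < 21 / 20 := by norm_num
  have hF0 : (1 : ℝ) * n ≤ i := by rw [one_mul]; exact_mod_cast hni.le
  have hi2r : (i : ℝ) ≤ 32 * n := by exact_mod_cast hi2
  rcases le_or_gt (i : ℝ) (14583 / 1000 * n) with h1 | h1
  · exact old_in_young_window_of_box' hmono hb hlo hh hf h56 hni m hV (by norm_num) hF0 h1 harg
      (cb := 407 / 500) (sl := 5851 / 10000) (by norm_num)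
  · exact old_in_young_window_of_box' hmono hb hlo hh hf h56 hni m hV (by norm_num) h1.le hi2r harg
      (cb := 9829 / 10000) (sl := 1 / 2) (by norm_num)

/-- **THE SPAN-32 CAP.**  ANY finite set `S` of ages inside `[lo, hi]` with `56 ≤ lo`, `hi ≤ 32·lo`, `hi < K`: `Σ_{k∈S} k·L_kh_{m+k}³∕2 ≤ 21 / 20` at every
pin ((E100e) `block_load_le_of_argmax` with the potential `k^4·h^10`). [folklore] -/
theorem old_block_load_le_span32 (hmono : ∀ u v : ℕ → ℝ, SeqBox γ u → SeqBox γ v → (∀ j, u j ≤ v j) → B u ≤ B v)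
    (hL : ∀ k, 0 ≤ L k) (hb : 0 < b) (hlo : ∀ u, SeqBox γ u → b ≤ B u) (hdom : ∀ u, SeqBox γ u → ∑ k ∈ range K, L k * u k ≤ B u)
    (hh : SeqBox γ h) (hf : MemFlow B gIR h) {S : Finset ℕ} {lo hi : ℕ} (h56 : 56 ≤ lo) (hhi : hi ≤ 32 * lo) (hhiK : hi < K)
    (hS : ∀ k ∈ S, lo ≤ k ∧ k ≤ hi) (m : ℕ) : ∑ k ∈ S, (k : ℝ) * (L k * h (m + k) ^ 3 / 2) ≤ 21 / 20 := by
  refine block_load_le_of_argmax hL hdom hh hf (fun k hk => lt_of_le_of_lt (hS k hk).2 hhiK) (by norm_num) (P := 4) (Q := (2 * (4 + 1))) m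
    fun i hi n hn harg => ?_
  obtain ⟨hi1, hi2⟩ := hS i hi
  obtain ⟨hn1, hn2⟩ := hS n hn
  rcases lt_trichotomy i n with hlt | heq | hgt
  · exact young_in_old_window_span32 hmono hb hlo hh hf (by omega) hlt (by omega) m harg
  · subst heq; exact own_window_le' hmono hb hlo hh hf (by omega) m (by norm_num)
  · exact old_in_young_window_span32 hmono hb hlo hh hf (by omega) hgt (by omega) m harg

end Summit.QuantumFields.BalabanUV.Beta.EriceRemainderEnclosureHistoryAutonomyComparisonAgeCompositionOldBlockCapWider
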